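import Summits.BirchSwinnertonDyer.BirchSwinnertonDyer.Theorems.ClassRecordThreeEulerHalvesAtThreeHybrid
import Summits.BirchSwinnertonDyer.BirchSwinnertonDyer.Theorems.ClassRecordThreeEulerHalvesAtThreeWalkSupplyAtThreeDisplayPrint
import Summits.BirchSwinnertonDyer.BirchSwinnertonDyer.Theorems.ClassRecordThreeEulerHalvesAtThreeTwistLowerOfX11a

/-!
# BC3 BIRTH skeleton v8h (HYBRID) for crux `EulerHalvesAtThree` (item stmt-BirchSwinnertonDyer-19109; routes `ClassRecordThree`
# r5 and `KolyvaginRoadThree`), line `Lines/hybrid.lean` (planner g36 RULING 30: the skeleton OF RECORD of 19109; namespace `.Hybrid`; tam3-p1 file 542cd558381ddbe9 otherwise VERBATIM) — seat `bsd-stepL-tam3-p1` g8, 2026-08-27: v8 (RULING 28 repair on the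
# registered v7; RULING 22 (B) kept) + RULING 25 (a)'s MERGE at the owner's discretion, EXERCISED: the two IMC-grade point-
# divisibility stubs on multi-carrier curves ↦ ONE stub `stub_coStepLMultiAtThree` (CoS₃ on multi-carrier curves only)

WHY THE MERGE (MEMO-J3-v7 §4). J₃ on multi-carrier frames (Jetchev's Conj. 1.3 beyond Thm. 1.4) is out of reach of every
Kolyvagin-SYSTEM method (rank-one-localisation obstruction: the doubly-stringent dual Selmer module at a core vertex has
invariants (m₁, m₂), one Kolyvagin prime localises into a rank-ONE `H¹_f(K_λ)^±`, and the Poitou–Tate count resets at every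
vertex — Büyükboduk 2008 Q1–Q2); the SUM over carriers is in print only through a main conjecture. corner3-p2 g2's hybrid
(p540392 `Koly.classRecordThree_eulerHalvesAtThree_of_jetchevMaxHL_of_coStepLMulti_of_twistLower` + KOLY twin) replaces the two
stubs on the SAME population by CoS₃ — the Kolyvagin-system «⊇» half of the anticyclotomic BDP main conjecture at `𝟙` in the
tree's `IMCUpperWaldspurgerOnTreeAt` currency, which is ⟺ the sharp `K`-bound there (control identity p528380) and is the
object the cell's UB road (bdp PROOF-BDP §55 THEOREM UB, memo-grade) delivers. Mono-carrier curves are served by the DERIVED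
Jetchev-max input (`Koly.jetchevMaxHLAtThree_of_facts_of_print`, p547155, six named Literature facts).
STUBS: `stub_localFactsAtThree` (CITABLE: hPT ∧ hF1 — as v8) · `stub_factsAtThree` (CITABLE: h52 ∧ h44 ∧ hGZ ∧ hmod ∧ hMcU ∧
hPT2 — v8's five + `poitouTate_sha_tateDual` (Poitou–Tate ∕ Cassels–Tate for Ш, the co-chain theorems' second duality input;
the plain `poitouTate_selmerStructure_duality` they also take is implied by hPT, `poitouTate_selmerStructure_duality_of_conj`))
· `stub_jetchevMaxHLAtThree` (DERIVED, registered signature unchanged) · `stub_coStepLMultiAtThree` (OPEN, IMC-grade, TIGHT —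
corner3-p2's `hcoMulti` binder VERBATIM) · `stub_x11aLowerHalfAtThree` (OPEN — RULING 22 (B); TL₃ DERIVED). Sorries ONLY in the
four `sorry`-stubs (two citable, two open). Compositions close BOTH route decls BY NAME modulo the stubs. Nothing is asserted
about any curve (T7). The non-merged v8 (five stubs, J₃-multi ×2 kept) is delivered alongside as the fallback.
-/

set_option linter.dupNamespace false
set_option autoImplicit false

noncomputable section

open scoped Classical NumberField Pointwise

namespace Summit.BirchSwinnertonDyer.BirchSwinnertonDyer.Cruxes.EulerHalvesAtThree.Hybrid

open WeierstrassCurve IsDedekindDomain NumberField Field Literature.NumberTheory.EllipticCurves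
  Literature.NumberTheory.EllipticCurves.ModularForms Literature.NumberTheory.EllipticCurves.Jetchev2008
  Literature.NumberTheory.EllipticCurves.KolyvaginCocycle
  Literature.NumberTheory.EllipticCurves.Rank1Residual Literature.NumberTheory.GaloisRepresentations
  Literature.NumberTheory.GaloisRepresentations.DiscreteGaloisModule
  Literature.NumberTheory.GaloisCohomology Literature.NumberTheory.Automorphic
  Summit.BirchSwinnertonDyer.Rank1Residual Summit.BirchSwinnertonDyer.Rank1Residual.X11b
  Summit.BirchSwinnertonDyer.Rank1Residual.X11b.Three Summit.BirchSwinnertonDyer.Rank1Residual.X11b.Three.Koly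
  Summit.BirchSwinnertonDyer.Rank1Residual.JET
  Literature.NumberTheory.EllipticCurves.Rank1Residual.Typed Literature.NumberTheory.QuadraticFields.Quadratic
  Summit.BirchSwinnertonDyer.Rank1Residual.X11b.AcSelmer

/-- **STUB (CITABLE — two cite-only Literature FACTS)**: the NAMED inputs of the supply theorem
`Koly.selmerSupplyAtThree_of_poitouTate_Gross1991` (p545834): `hPT` (Poitou–Tate duality for Selmer structures with a
conjugation-compatible family = the tree's named fact `poitouTate_selmerStructure_duality_conj` for every number field; Milne
ADT I 4.10 + Howard 2.1.11 + Neukirch III §6) and `hF1` (Gross 1991 §6, proof of Prop. 6.2 (1), from [GZ86 III (3.1)]: at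
square-free Kolyvagin conductors the Heegner point `y_n` lies in `E⁰` at every place over `N` UP TO A RATIONAL TORSION POINT =
the tree's named fact `Gross1991_heegnerPoint_sub_ratTorsion_mem_E0`, BY NAME — RULING 28's preferred form). v7's conjunct 2,
the unguarded receptacle schema (stub-false as typed: witness 11a1 ∕ ℚ(√−7) ∕ p = 5 ∕ m = 1, mult-p3 g2), is gone.
[cite: MilneADT2006, Ch. I, Thm. 4.10(b)] [cite: Howard2004HeegnerKolyvagin, Thm. 2.1.11]
[cite: GrossLMS1991, §6 proof of Prop. 6.2 (1) (p. 245)] [cite: GrossZagier1986, III (3.1)] -/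
theorem stub_localFactsAtThree :
    (∀ (K : Type) [Field K] [NumberField K], poitouTate_selmerStructure_duality_conj K) ∧
    Gross1991_heegnerPoint_sub_ratTorsion_mem_E0 := by
  sorry

/-- **STUB (CITABLE, by Literature decl name)**: the print facts feeding the display and the composition that are NOT proved
in the tree — McCallum 1991 Prop. 5.2 and Prop. 4.4 (typed named facts), Gross–Zagier I (6.3), modularity (both also conjuncts
of `PublishedInputsThree`; kept here so that the DERIVED `stub_jetchevMaxHLAtThree` is a closed term), McCallum Cor. 5.6, and
(v8h) Poitou–Tate ∕ Cassels–Tate for Ш `poitouTate_sha_tateDual` (the co-chain theorems' second duality input).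
v7's `h53` (Gross Prop. 5.3), `hD36` (Darmon 3.6) and `hrec` (Gross §4) are THEOREMS of the tree and are gone.
[cite: McCallumLMS1991, §4 Prop. 4.4, §5 Prop. 5.2, Cor. 5.6] [cite: GrossZagier1986, Thm. I.(6.3)] [cite: BCDTJAMS2001, Thm. A]
[cite: MilneADT2006, Ch. I, Thm. 4.10(b), Thm. 6.13] -/
theorem stub_factsAtThree :
    McCallum1991.prop52_exists_conductor_kolyvaginClass_order_eq ∧
    McCallum1991.prop44_localOrder_kolyvaginClass_mul_eq ∧
    (∀ (N : ℕ) [NeZero N] (W : WeierstrassCurve ℚ) (K : Type) [Field K] [NumberField K],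
      gross_zagier N W K) ∧
    hasEntireLFunction_rat ∧
    McCallum1991_padicValNat_card_sha_primary_add_le_of_globalDivisibility ∧
    (∀ (K : Type) [Field K] [NumberField K], poitouTate_sha_tateDual K) := by
  sorry

/-- **The registered stub `stub_jetchevMaxHLAtThree` (Jetchev Thm. 1.4, MAX form, at `3 ∥ N`), CLOSED MODULO the two CITABLE stubs
`stub_factsAtThree` + `stub_localFactsAtThree`** (six named Literature facts in all) by the tree's display
`Koly.jetchevMaxHLAtThree_of_facts_of_print` (seat g8, p547155). [cite: Jetchev2008, Thm. 1.4 (p. 812), Proof of Thm. 1.4 (p. 825)] -/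
theorem stub_jetchevMaxHLAtThree :
    ∀ (W : WeierstrassCurve ℚ) [W.IsElliptic] [W.IsGloballyMinimal] [NeZero (W.conductorNorm ℤ)]
      (K : Type) [Field K] [NumberField K]
      (Dt : ModularParametrizationData W (W.conductorNorm ℤ)) (β : ℤ) (ι : K →+* ℂ),
      W.analyticRank = 1 → W.HasMultiplicativeReductionAtPrime 3 → Surj W 3 →
      IsImaginaryQuadratic K → SatisfiesHeegnerHypothesis (W.conductorNorm ℤ) K →
      Odd (NumberField.discr K) → (W.quadraticTwist (NumberField.discr K : ℚ)).entireLFunction 1 ≠ 0 →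
      (4 * (W.conductorNorm ℤ : ℤ)) ∣ β ^ 2 - NumberField.discr K → ¬ (3 : ℤ) ∣ Dt.c →
      ∀ (v : HeightOneSpectrum (𝓞 ℚ)) (s : ℕ), s ≤ padicValNat 3 (W.tamagawaNumberAt v) →
        ∀ (n : ℕ) (d : KolyvaginHeegnerData Dt β ι n), Squarefree n →
          (∀ ℓ ∈ n.primeFactors, Zhang2014.IsKolyvaginPrime (W.conductorNorm ℤ) W K 3 ℓ ∧
            s ≤ Zhang2014.kolyvaginIndex W 3 ℓ) → PDiv d 3 s :=
  jetchevMaxHLAtThree_of_facts_of_print stub_factsAtThree.1 stub_factsAtThree.2.1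
    stub_factsAtThree.2.2.1 stub_factsAtThree.2.2.2.1 stub_localFactsAtThree.1 stub_localFactsAtThree.2

/-- **STUB (OPEN, IMC-grade, TIGHT)**: CoS₃ on MULTI-carrier curves only — corner3-p2 g2's `hcoMulti` binder VERBATIM (p540392):
the «⊇» half of the anticyclotomic BDP main conjecture at `𝟙` in the tree's `IMCUpperWaldspurgerOnTreeAt` currency, on every surj
X11b@3 odd Heegner frame of a curve with `∀ v, ord₃ c_v(E) < ord₃ ∏c`. Replaces v7's `stub_jetchevDivisibility{Ram,NotRam}HLMultiAtThree`
(J₃ on multi-carrier frames — a documented SUFFICIENT attack on this stub, out of reach of Kolyvagin-system methods).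
[cite: JetchevSkinnerWan2017, §7.4.2 (arXiv:1512.06894 p. 31)] [cite: Castella2018, Thm. 2.3 (p. 5), Thm. 3.2 (p. 9)] -/
theorem stub_coStepLMultiAtThree :
    ∀ (W : WeierstrassCurve ℚ) [W.IsElliptic] [W.IsGloballyMinimal],
      (∀ v : HeightOneSpectrum (𝓞 ℚ),
        padicValNat 3 (W.tamagawaNumberAt v) < padicValNat 3 W.tamagawaProduct) →
      ∀ (N : ℕ) [NeZero N] (K : Type) [Field K] [NumberField K]
        (Dt : ModularParametrizationData W N) (H : HeegnerDatum N (NumberField.discr K)) (ι : K →+* ℂ)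
        (P : (W.baseChange K).toAffine.Point),
        ClassX11b W 3 → Surj W 3 → W.conductorNorm ℤ = N → IsImaginaryQuadratic K →
        Odd (NumberField.discr K) → SatisfiesHeegnerHypothesis N K →
        (W.quadraticTwist (NumberField.discr K : ℚ)).entireLFunction 1 ≠ 0 →
        WeierstrassCurve.Affine.Point.map ι.toRatAlgHom P = heegnerPointComplex Dt H →
        ¬ (3 : ℤ) ∣ Dt.c → ¬ IsOfFinAddOrder P →
        ∀ (κ : ZpExtension K 3), κ.IsAnticyclotomic →
          ∀ (γ : Field.absoluteGaloisGroup K) [Fact (κ.IsTopGenerator γ)]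
            (𝔭 : HeightOneSpectrum (𝓞 K)) (h𝔭 : ((3 : ℕ) : 𝓞 K) ∈ 𝔭.asIdeal)
            (he : 𝔭.asIdeal.ramificationIdx (𝓞 ℚ) = 1) (hf : 𝔭.asIdeal.inertiaDeg (𝓞 ℚ) = 1),
            IMCUpperWaldspurgerOnTreeAt 3 κ 𝔭 γ (embAt K 3 𝔭 h𝔭 he hf) P := by
  sorry

/-- STUB (OPEN — v4 ∕ v7, RULING 22 (B)): the X11a LOWER HALF AT 3 = item 19064 `MissingLowerBoundAtThreeX11a`'s
statement READ AT `p = 3` only (`ClassX11a V 3` = analytic rank 0 ∧ 3 ≠ 2 ∧ Mult ∧ Irr ∧ ¬Ram at 3 →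
`Typed.MissingLowerBoundAt V 3`, the main-conjecture-direction half of BSD(V, 3)). mult-p3 g0 (p526914 ∕ p527466 ∕
p533905's sibling `…TwistLowerOfX11a.lean`) showed TL₃ ⟺ this on the tree's published record; it is the genuine open
object behind TL₃ (the (ram) sub-case of TL₃ is Skinner 2016 Thm C with equality, published). [cite: Skinner2016PacificMC,
Thm. C (§1)] [cite: SkinnerUrban2014, Thm. 3.29 ∕ §3.6 — the multiplicative unramified case is NOT covered there: open] -/
theorem stub_x11aLowerHalfAtThree :
    ∀ (V : WeierstrassCurve ℚ) [V.IsElliptic] [V.IsGloballyMinimal],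
      Summit.BirchSwinnertonDyer.Rank1Residual.ClassX11a V 3 →
        Literature.NumberTheory.EllipticCurves.Rank1Residual.Typed.MissingLowerBoundAt V 3 := by
  sorry

/-- TL₃ (v1 ∕ v3's `stub_twistLowerAtThree`, statement VERBATIM) — **v4 ∕ v7: NO LONGER A STUB**: derived from
`stub_x11aLowerHalfAtThree` and three conjuncts of `PublishedInputsThree` (modularity, GZK, Skinner 2016 Thm C) by
mult-p3 g0's `Koly.twistLowerAtThree_of_thmC_of_x11aLowerHalfAtThree` (`Theorems/ClassRecordThreeEulerHalvesAtThreeTwistLowerOfX11a.lean`). -/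
theorem twistLowerAtThree_of_x11aLowerHalf (hmod : hasEntireLFunction_rat)
    (hGZK : rank_eq_analyticRank_of_analyticRank_le_one)
    (hSk : Skinner2016.thmC_padicValRat_bsd_rank_zero) :
    ∀ (V : WeierstrassCurve ℚ) [V.IsElliptic] [V.IsGloballyMinimal],
      V.HasMultiplicativeReductionAtPrime 3 → V.HasIrreducibleModPGaloisRep 3 →
      V.entireLFunction 1 ≠ 0 → Finite V.sha →
      ∃ q : ℚ, V.entireLFunction 1 / (V.realPeriodRat : ℂ) = (q : ℂ) ∧
        padicValRat 3 q ≤ (padicValNat 3 V.shaOrder : ℤ) + padicValNat 3 V.tamagawaProduct -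
          2 * padicValNat 3 V.torsionOrder :=
  Summit.BirchSwinnertonDyer.Rank1Residual.X11b.Three.Koly.twistLowerAtThree_of_thmC_of_x11aLowerHalfAtThree
    hmod hGZK hSk stub_x11aLowerHalfAtThree

/-- **Composition**: the crux BY NAME from `PublishedInputsThree` (item 19112, by name) and the stubs,
through corner3-p2's HYBRID (p540392); `hrec`/`hD36` are the Literature theorems, the plain Poitou–Tate from hPT. -/
theorem EulerHalvesAtThree_of
    (h : Summit.BirchSwinnertonDyer.BirchSwinnertonDyer.Theses.ClassRecordThree.PublishedInputsThree) :
    Summit.BirchSwinnertonDyer.BirchSwinnertonDyer.Theses.ClassRecordThree.EulerHalvesAtThree := by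
  obtain ⟨hGZ, hKo, -, hSk, -, hGZK, hmod, hnf, hHL, hMaz, -, -, -, -, -, -, -, -, -, -⟩ := h
  obtain ⟨-, -, -, -, hMcU, hPT2⟩ := stub_factsAtThree
  exact classRecordThree_eulerHalvesAtThree_of_jetchevMaxHL_of_coStepLMulti_of_twistLower hGZ hKo hSk hGZK hmod
    hnf hHL hMaz (fun N _ W K _ _ ↦ heegnerPointOfConductor_one_galoisConj_holds N W K)
    (fun N _ W K _ _ ↦ phi_heegnerTau_mem_singularModuliField_holds N W K) hMcU
    (fun K _ _ ↦ poitouTate_selmerStructure_duality_of_conj (stub_localFactsAtThree.1 K)) hPT2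
    stub_jetchevMaxHLAtThree stub_coStepLMultiAtThree (twistLowerAtThree_of_x11aLowerHalf hmod hGZK hSk)

/-- **The `KolyvaginRoadThree` twin** (same statement). -/
theorem EulerHalvesAtThree_of'
    (h : Summit.BirchSwinnertonDyer.BirchSwinnertonDyer.Theses.ClassRecordThree.PublishedInputsThree) :
    Summit.BirchSwinnertonDyer.BirchSwinnertonDyer.Theses.KolyvaginRoadThree.EulerHalvesAtThree := by
  obtain ⟨hGZ, hKo, -, hSk, -, hGZK, hmod, hnf, hHL, hMaz, -, -, -, -, -, -, -, -, -, -⟩ := h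
  obtain ⟨-, -, -, -, hMcU, hPT2⟩ := stub_factsAtThree
  exact kolyvaginRoadThree_eulerHalvesAtThree_of_jetchevMaxHL_of_coStepLMulti_of_twistLower hGZ hKo hSk hGZK hmod
    hnf hHL hMaz (fun N _ W K _ _ ↦ heegnerPointOfConductor_one_galoisConj_holds N W K)
    (fun N _ W K _ _ ↦ phi_heegnerTau_mem_singularModuliField_holds N W K) hMcU
    (fun K _ _ ↦ poitouTate_selmerStructure_duality_of_conj (stub_localFactsAtThree.1 K)) hPT2
    stub_jetchevMaxHLAtThree stub_coStepLMultiAtThree (twistLowerAtThree_of_x11aLowerHalf hmod hGZK hSk)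

end Summit.BirchSwinnertonDyer.BirchSwinnertonDyer.Cruxes.EulerHalvesAtThree.Hybrid

end
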